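import Summits.BirchSwinnertonDyer.BirchSwinnertonDyer.Theorems.EdixhovenFibreFiveSevenStarredOptimalManinUnitFiveSevenUnramifiedTorsion
import Summits.BirchSwinnertonDyer.BirchSwinnertonDyer.Theorems.KimAtThreeFineKatoKPortGoodSubgroup
import Literature.NumberTheory.EllipticCurves.DivisionPolynomialCuspJets
import HarnessLib

/-!
# No `p`-torsion in `E₀(K)` at an ADDITIVE prime `p ≥ 11` over an UNRAMIFIED `p`-adic field —
# the torsion input of the Kim–Nakamura / Kosters–Pannekoek receptacle beyond the K★ slice

Route `EdixhovenFibreFiveSeven`, crux K★ `StarredOptimalManinUnitFiveSeven` (stmt-BirchSwinnertonDyer-22226),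
line `kato-lever`, seat `bsd-line-edix-p2` g4; `--supports` 22226 (helper toward the ONE open stub F″ =
`Literature.NumberTheory.EllipticCurves.kato_neron_isIntegral_twistedSymbolSum_of_additive_five_le`, programme
piece P2 of `Cruxes/StarredOptimalManinUnitFiveSeven/Lines/kato-lever-F2-programme.md`, the TORSION INPUT
`E₀(K_v)[p] = 0` of the receptacle `log_ω : E₀(K_v) ⊗ ℤ_p ≅ 𝒪_{K_v}`). TOOL theorems only (no definition, no
named fact, no `sorry`); nothing is closed or booked; BSD is not proved by any of this.

WHY. F″ quantifies over every additive prime `p ≥ 5` with the side clause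
`7 < p ∨ (gcd(ord_m p, p − 1) = 1 ∧ V(ℚ_p)[p] = 0)`; its receptacle is applied over the completions
`K_v = ℚ(ζ_m)_v`, `v ∣ p`, UNRAMIFIED of degree `ord_m p`, and needs `E₀(K_v)[p] = 0` there. The sibling file
`…StarredOptimalManinUnitFiveSevenUnramifiedTorsion` (seat edix-p1 g4, p595215) supplies this on the K★ slice
(`p ∈ {5, 7}`, `‖a‖, ‖b‖ ≤ ‖p‖²`). THIS file supplies the branch `7 < p` — by Kosters–Pannekoek Thm. 1 there is
NO exceptional case for `p > 7` — as the `p ≥ 11` twin: on `y² = x³ + p a′x + p b′` (any commutative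
coefficient ring `R` with `840 ∈ Rˣ`, read in ANY ultrametric normed field `K` through `f : R → K` with
`‖f r‖ ≤ 1` and `0 < ‖p‖ < 1`) the first-order cusp expansion of the tree
(`CuspJets.preΨ'_eval_sub_cuspLinear_mem`: both first-order coefficients of `ψ_p` carry the factor `p`) gives
the POLYNOMIAL identity `ψ_p = p·X^{(p²−1)/2} + p²·T` in `R[X]`, hence `ψ_p(x) ≠ 0` at every unit `x`, hence
no `p`-torsion with unit abscissa; with the kernel case of the tree (`UnramifiedKernelTorsion`, unramified `K`)
no point with `‖x‖ ≥ 1` is killed by `p`; and on the cuspidal short model the points of `E₀(K) ∖ {O}` are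
exactly those with `‖x‖ ≥ 1` (the tree's norm criterion `KPort.some_mem_nonsingularReductionSubgroup_iff_norm`),
so **`E₀(K)[p] = 0`** in the K-port currency `BallEval.curveK p K (shortCurve A B)`, `A, B ∈ pℤ_p`, `p ≥ 11`.
(The port of Mazur's Step 1 at `q = N ≥ 11`, tree `MazurTorsionStepOneAtNProofs.not_prime_zsmul_eq_zero_of_norm_eq_one`,
from `ℤ_p` to absolute ramification index `1`.) The transport from an arbitrary additive minimal model over `ℤ_p`
to its short form (`toShortNF`, `u = 1`) is not repeated here (sibling seat edix-p5, piece P2e).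

* §1 `exists_preΨ'_eq_add_sq_mul` — `ψ_{2j+3} = (2j+3)·X^{2j²+6j+4} + (2j+3)²·T` in `R[X]` for
  `y² = x³ + (2j+3)a′x + (2j+3)b′`, `840 ∈ Rˣ`.
* §2 `not_prime_zsmul_eq_zero_of_norm_eq_one` — unit abscissa, any ultrametric `K`, `p ≥ 3` with `840 ∈ Rˣ`.
* §3 `not_prime_zsmul_eq_zero_of_one_le_norm_unramified` — `‖x‖ ≥ 1`, `K` unramified.
* §4 `KPort` currency (`K` a complete? no — any ultrametric normed `ℚ_p`-algebra field, `M = shortCurve A B` over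
  `ℤ_p`, `‖A‖, ‖B‖ < 1`, `11 ≤ p`): `one_le_norm_of_mem_nonsingularReductionSubgroup_short` (`E₀(K) ∖ {O}` has
  `‖x‖ ≥ 1`), **`eq_zero_of_prime_nsmul_eq_zero_of_mem_nonsingularReductionSubgroup_short`** (`E₀(K)[p] = 0`).

References: [KostersPannekoek2017] M. Kosters, R. Pannekoek, arXiv:1703.07888, Thm. 1 (no exceptional case for
`p > 7`); [KimNakamura2020] C.-H. Kim, K. Nakamura, J. Number Theory 210 (2020), Thm. 2.1, Remark 1.8 (1);
[Mazur1977] B. Mazur, Publ. Math. IHÉS 47 (1977), Ch. III §5 Step 1 (method); [SilvermanAEC2009] J. H. Silverman,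
*The Arithmetic of Elliptic Curves*, 2nd ed., Exercise 3.7(d),(f), VII.2.1, VII.3.1.
-/

set_option autoImplicit false
-- the Theorems namespace of a single-conjunct summit repeats the summit name by design (D-0017)
set_option linter.dupNamespace false

noncomputable section

open scoped Classical
open _root_.WeierstrassCurve _root_.Polynomial
open Literature.NumberTheory.EllipticCurves Literature.NumberTheory.EllipticCurves.CuspJets
open Summit.BirchSwinnertonDyer.Rank1Residual.Additive.CuspTorsion
open Summit.BirchSwinnertonDyer.BirchSwinnertonDyer.Theorems.StarredOptimalManinUnitFiveSevenUnramifiedTorsion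

namespace Summit.BirchSwinnertonDyer.BirchSwinnertonDyer.Theorems.ReceptacleTorsion

variable {K : Type*} [NontriviallyNormedField K] [IsUltrametricDist K]
  {R : Type*} [CommRing R] (f : R →+* K)

/-! ## §1 `ψ_p = p·X^{(p²−1)/2} + p²·T` for `y² = x³ + p a′x + p b′` (`840 ∈ Rˣ`) -/

omit [NontriviallyNormedField K] [IsUltrametricDist K] in
/-- **`ψ_n = n·X^{(n²−1)/2} + n²·T` in `R[X]`** for `n = 2j + 3` and the short curve `y² = x³ + n a′·x + n b′`
over a commutative ring `R` with `840 w = 1`: the tree's first-order cusp expansion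
`ψ_n ≡ n X^{(n²−1)/2} + a·n(…)w X^{…} + b·n(…)w X^{…} (mod (a, b)²)` (both first-order coefficients carry
the factor `n`) with `a = n a′`, `b = n b′`, so that `(a, b)² ⊆ (n²)`.
[cite: SilvermanAEC2009, Exercise 3.7(a),(b),(d) (PDF pp. 97–98)] [cite: Mazur1977, Ch. III §5, Step 1, p. 158] -/
theorem exists_preΨ'_eq_add_sq_mul {w : R} (hw : 840 * w = 1) (j : ℕ) (a' b' : R) :
    ∃ T : R[X], (shortCurve ((2 * j + 3 : ℕ) * a') ((2 * j + 3 : ℕ) * b')).preΨ' (2 * j + 3) =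
      ((2 * j + 3 : ℕ) : R[X]) * X ^ (2 * j ^ 2 + 6 * j + 4) + ((2 * j + 3 : ℕ) : R[X]) ^ 2 * T := by
  set n : ℕ := 2 * j + 3 with hn
  have hw' : (840 : R[X]) * C w = 1 := by
    rw [← map_ofNat C 840, ← map_mul, hw, map_one]
  have h := preΨ'_eval_sub_cuspLinear_mem (X : R[X]) (C ((n : R) * a')) (C ((n : R) * b')) hw' j
  rw [← map_shortCurve, WeierstrassCurve.map_preΨ', eval_map, eval₂_C_X] at h
  -- `(a, b)² ⊆ (n²)`
  have hle : cuspIdealSq (C ((n : R) * a')) (C ((n : R) * b')) ≤ Ideal.span {((n : R[X])) ^ 2} := by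
    rw [cuspIdealSq, ← Ideal.span_singleton_pow]
    refine Ideal.pow_right_mono ?_ 2
    rw [Ideal.span_le]
    rintro z (rfl | rfl)
    · exact Ideal.mem_span_singleton.mpr ⟨C a', by rw [map_mul, map_natCast]⟩
    · exact Ideal.mem_span_singleton.mpr ⟨C b', by rw [map_mul, map_natCast]⟩
  obtain ⟨T₀, hT₀⟩ := Ideal.mem_span_singleton.mp (hle h)
  have hcast : (2 * (j : R[X]) + 3) = (n : R[X]) := by push_cast [hn]; ring
  refine ⟨T₀ + (C a' * (14 * (((n : R[X])) ^ 2 - 1) * ((n : R[X]) ^ 2 + 6) * C w *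
      X ^ (2 * j ^ 2 + 6 * j + 2)) + C b' * (4 * ((n : R[X]) ^ 2 - 1) *
      (((n : R[X]) ^ 2) ^ 2 + (n : R[X]) ^ 2 + 15) * C w * X ^ (2 * j ^ 2 + 6 * j + 1))), ?_⟩
  rw [hcast, map_mul, map_mul, map_natCast] at hT₀
  linear_combination hT₀

/-! ## §2 The unit-abscissa case (any ultrametric `K`) -/

omit [IsUltrametricDist K] in
/-- Leading-term domination at a unit: `c·x^N + c²·t ≠ 0` for `0 < ‖c‖ < 1`, `‖x‖ = 1`, `‖t‖ ≤ 1`. [folklore] -/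
private theorem ne_zero_of_norm_le_one {c t x : K} (hc0 : c ≠ 0) (hc1 : ‖c‖ < 1) (hx : ‖x‖ = 1) (N : ℕ)
    (ht : ‖t‖ ≤ 1) : c * x ^ N + c ^ 2 * t ≠ 0 := by
  intro h
  have hc : 0 < ‖c‖ := norm_pos_iff.mpr hc0
  have h1 : ‖c * x ^ N‖ = ‖c‖ := by rw [norm_mul, norm_pow, hx, one_pow, mul_one]
  rw [add_eq_zero_iff_eq_neg] at h
  rw [h, norm_neg, norm_mul, norm_pow] at h1
  nlinarith

/-- **No `p`-torsion with unit abscissa on `y² = x³ + p a′x + p b′`, `840 ∈ Rˣ` (so `p ≥ 11` as soon as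
`‖p‖ < 1`).** Coefficients in `R`, read in ANY ultrametric normed field `K` through `f : R → K` with
`‖f r‖ ≤ 1` and `0 < ‖p‖ < 1`, `p` an odd prime: a point `(x, y)` with `‖x‖ = 1` is not killed by `p`.
Proof: `p • P = O ⇒ ψ_p(x) = 0`, but `ψ_p(x) = p x^{(p²−1)/2} + p² T(x)` with `‖T(x)‖ ≤ 1` (§1).
The `p ≥ 11` twin of `not_five/seven_zsmul_eq_zero_of_norm_eq_one` (edix-p1 g4) and the port of the tree's
`ℤ_p`-statement `MazurTorsionStepOneAtNProofs.not_prime_zsmul_eq_zero_of_norm_eq_one` to absolute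
ramification index `1` (indeed to any ultrametric `K`).
[cite: Mazur1977, Ch. III §5, Step 1, p. 158] [cite: SilvermanAEC2009, Exercise 3.7(d),(f)]
[cite: KostersPannekoek2017, Thm. 1 (no exceptional case for p > 7)] -/
theorem not_prime_zsmul_eq_zero_of_norm_eq_one (hf : ∀ r, ‖f r‖ ≤ 1) {p : ℕ} [Fact p.Prime] (hp3 : 3 ≤ p)
    {w : R} (hw : 840 * w = 1) (a' b' : R) [((shortCurve ((p : R) * a') ((p : R) * b')).map f).IsElliptic]
    (hp0 : (p : K) ≠ 0) (hp1 : ‖(p : K)‖ < 1) {x y : K}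
    (h : ((shortCurve ((p : R) * a') ((p : R) * b')).map f).toAffine.Nonsingular x y) (hx : ‖x‖ = 1) :
    (p : ℤ) • (Affine.Point.some x y h : ((shortCurve ((p : R) * a') ((p : R) * b')).map f).toAffine.Point) ≠ 0 := by
  obtain ⟨j, hj⟩ : ∃ j : ℕ, p = 2 * j + 3 := by
    rcases (Fact.out : p.Prime).eq_two_or_odd' with h2 | ⟨k, hk⟩
    · omega
    · exact ⟨k - 1, by omega⟩
  have hodd : ¬ Even p := by rw [hj, Nat.not_even_iff_odd]; exact ⟨j + 1, by ring⟩
  intro h0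
  have h1 := eval_map_preΨ'_eq_zero_of_zsmul_eq_zero f (shortCurve ((p : R) * a') ((p : R) * b')) hodd h
    (by exact_mod_cast h0)
  obtain ⟨T, hT⟩ := exists_preΨ'_eq_add_sq_mul hw j a' b'
  subst hj
  rw [hT] at h1
  simp only [Polynomial.map_add, Polynomial.map_mul, Polynomial.map_pow, map_X, Polynomial.map_natCast,
    eval_add, eval_mul, eval_pow, eval_X, eval_natCast] at h1
  exact ne_zero_of_norm_le_one hp0 hp1 hx _ (norm_eval_map_le_one f hf T hx.le) h1

/-! ## §3 Abscissa of norm `≥ 1` over an UNRAMIFIED field -/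

/-- **No `p`-torsion with abscissa of norm `≥ 1` on `y² = x³ + p a′x + p b′` over an unramified `p`-adic
field** (`K` ultrametric with `0 < ‖p‖ < 1` and `‖z‖ < 1 ⇒ ‖z‖ ≤ ‖p‖`, absolute ramification index `1`, e.g.
`ℚ(ζ_m)_v` for `p ∤ m`; `840 ∈ Rˣ`, i.e. `p ≥ 11`): the unit case is §2, the kernel-of-reduction case
`‖x‖ > 1` is the tree's `UnramifiedKernelTorsion.not_prime_zsmul_eq_zero_of_one_lt_norm_unramified`. At a
globally minimal curve over `ℚ` additive at `p ≥ 11` the short minimal model `y² = x³ − (c₄/48)x − c₆/864`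
has `a, b ∈ pℤ_p`, so this is every such curve (Kosters–Pannekoek: no exceptional case for `p > 7`).
[cite: SilvermanAEC2009, VII.3 Prop. 3.1 and Exercise 3.7(d),(f)] [cite: KostersPannekoek2017, Thm. 1] -/
theorem not_prime_zsmul_eq_zero_of_one_le_norm_unramified (hf : ∀ r, ‖f r‖ ≤ 1) {p : ℕ} [Fact p.Prime]
    (hp3 : 3 ≤ p) {w : R} (hw : 840 * w = 1) (a' b' : R)
    [((shortCurve ((p : R) * a') ((p : R) * b')).map f).IsElliptic]
    (hp0 : (p : K) ≠ 0) (hp1 : ‖(p : K)‖ < 1) (hdisc : ∀ z : K, ‖z‖ < 1 → ‖z‖ ≤ ‖(p : K)‖) {x y : K}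
    (h : ((shortCurve ((p : R) * a') ((p : R) * b')).map f).toAffine.Nonsingular x y) (hx : 1 ≤ ‖x‖) :
    (p : ℤ) • (Affine.Point.some x y h : ((shortCurve ((p : R) * a') ((p : R) * b')).map f).toAffine.Point) ≠ 0 := by
  rcases hx.eq_or_lt with hx1 | hx1
  · exact not_prime_zsmul_eq_zero_of_norm_eq_one f hf hp3 hw a' b' hp0 hp1 h hx1.symm
  · exact UnramifiedKernelTorsion.not_prime_zsmul_eq_zero_of_one_lt_norm_unramified f hf
      (shortCurve ((p : R) * a') ((p : R) * b')) hp3 hp0 hp1 hdisc h hx1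


/-! ## §4 The K-port currency: `E₀(K)[p] = 0` on the cuspidal short model over `ℤ_p`, `p ≥ 11` -/

section KPort

open Summit.BirchSwinnertonDyer.Rank1Residual.Additive Summit.BirchSwinnertonDyer.Rank1Residual.Additive.BallEval
open Literature.NumberTheory.GaloisRepresentations.LubinTate (unitBall mem_unitBall_iff)

variable {p : ℕ} [hp : Fact p.Prime] {L : Type*} [NontriviallyNormedField L] [NormedAlgebra ℚ_[p] L]
  [IsUltrametricDist L]

/-- The coefficient map `ℤ_p → 𝒪_L ⊂ L` of the K-port is norm-non-increasing (indeed isometric). [folklore] -/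
theorem norm_subtype_comp_coeffHom_le_one (r : ℤ_[p]) :
    ‖((unitBall L).subtype.comp (coeffHom p L)) r‖ ≤ 1 := by
  change ‖((coeffHom p L r : unitBall L) : L)‖ ≤ 1
  rw [norm_coe_coeffHom]
  exact PadicInt.norm_le_one r

/-- **On the cuspidal short model `y² = x³ + Ax + B`, `A, B ∈ pℤ_p`, over any ultrametric normed
`ℚ_p`-field `L`, a point of `E₀(L) ∖ {O}` has abscissa of norm `≥ 1`**: a point with `‖x‖ < 1` has
`‖y‖ < 1` and reduces to the cusp `(0, 0)` (the tree's norm criterion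
`KPort.some_mem_nonsingularReductionSubgroup_iff_norm`: `‖3x² + A‖ < 1`, `‖2y‖ < 1`).
[cite: SilvermanAEC2009, VII.2 Prop. 2.1 and III.1] -/
theorem one_le_norm_of_some_mem_nonsingularReductionSubgroup_short {A B : ℤ_[p]} (hA : ‖A‖ < 1)
    (hB : ‖B‖ < 1) {x y : L} (h : (curveK p L (shortCurve A B)).toAffine.Nonsingular x y)
    (hP : (Affine.Point.some x y h : (curveK p L (shortCurve A B)).toAffine.Point) ∈
      ((shortCurve A B).map (coeffHom p L)).nonsingularReductionSubgroup
        (Valuation.integer.integers (NormedField.valuation (K := L)))) :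
    1 ≤ ‖x‖ := by
  by_contra hx
  push Not at hx
  rw [KPort.some_mem_nonsingularReductionSubgroup_iff_norm] at hP
  obtain ⟨e₁, e₂, e₃, e₄, e₆⟩ := curveK_a (p := p) (K := L) (M := shortCurve A B)
  have h₁ : (curveK p L (shortCurve A B)).a₁ = 0 := by rw [e₁]; simp
  have h₂ : (curveK p L (shortCurve A B)).a₂ = 0 := by rw [e₂]; simp
  have h₃ : (curveK p L (shortCurve A B)).a₃ = 0 := by rw [e₃]; simp
  have h₄ : ‖(curveK p L (shortCurve A B)).a₄‖ < 1 := by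
    rw [e₄]; change ‖((coeffHom p L A : unitBall L) : L)‖ < 1; rw [norm_coe_coeffHom]; exact hA
  have h₆ : ‖(curveK p L (shortCurve A B)).a₆‖ < 1 := by
    rw [e₆]; change ‖((coeffHom p L B : unitBall L) : L)‖ < 1; rw [norm_coe_coeffHom]; exact hB
  have hx1 : ‖x‖ ≤ 1 := hx.le
  -- `‖y‖ < 1` from the equation `y² = x³ + a₄ x + a₆`
  have heq := (Affine.equation_iff _ _).mp h.1
  rw [h₁, h₂, h₃] at heq
  simp only [zero_mul, add_zero] at heq
  have hy : ‖y‖ < 1 := by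
    have hr : ‖x ^ 3 + (curveK p L (shortCurve A B)).a₄ * x + (curveK p L (shortCurve A B)).a₆‖ < 1 := by
      refine (IsUltrametricDist.norm_add_le_max _ _).trans_lt (max_lt ((IsUltrametricDist.norm_add_le_max _ _).trans_lt
        (max_lt ?_ ?_)) h₆)
      · rw [norm_pow]; exact pow_lt_one₀ (norm_nonneg _) hx three_ne_zero
      · rw [norm_mul]; exact mul_lt_one_of_nonneg_of_lt_one_left (norm_nonneg _) h₄ hx1
    rw [← heq, norm_pow] at hr
    by_contra hy1
    push Not at hy1
    exact absurd hr (not_lt.mpr (one_le_pow₀ hy1))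
  rcases hP with hx' | hd | hy'
  · exact absurd hx' (not_lt.mpr hx1)
  · rw [h₁, h₂, zero_mul, mul_zero, zero_sub, norm_neg] at hd
    have : ‖3 * x ^ 2 + 0 * x + (curveK p L (shortCurve A B)).a₄‖ < 1 := by
      rw [zero_mul, add_zero]
      refine (IsUltrametricDist.norm_add_le_max _ _).trans_lt (max_lt ?_ h₄)
      rw [norm_mul, norm_pow]
      exact mul_lt_one_of_nonneg_of_lt_one_right (by exact_mod_cast IsUltrametricDist.norm_natCast_le_one L 3)
        (by positivity) (pow_lt_one₀ (norm_nonneg _) hx two_ne_zero)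
    exact absurd hd this.ne
  · rw [h₁, h₃, zero_mul, add_zero, add_zero, norm_mul] at hy'
    exact absurd hy' (mul_lt_one_of_nonneg_of_lt_one_right (by exact_mod_cast IsUltrametricDist.norm_natCast_le_one L 2)
      (norm_nonneg _) hy).ne

/-- **`E₀(L)[p] = 0` on the cuspidal short model over `ℤ_p` at `p ≥ 11`, over every UNRAMIFIED ultrametric
normed `ℚ_p`-field `L`** (`‖z‖ < 1 ⇒ ‖z‖ ≤ ‖p‖`; e.g. `ℚ(ζ_m)_v`, `p ∤ m`): for `M = (y² = x³ + Ax + B)` with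
`A, B ∈ pℤ_p` (the short form of ANY additive minimal model at `p ≥ 5`; at `p ≥ 11` no further condition —
Kosters–Pannekoek: no exceptional case for `p > 7`), every `P ∈ E₀(L)` of `BallEval.curveK p L M` with
`p • P = O` is `O`. The torsion input of the receptacle `Λ̃(E₀(L)) = 𝒪_L` (programme piece P2) in the branch
`7 < p` of F″. [cite: KostersPannekoek2017, Thm. 1] [cite: KimNakamura2020, Thm. 2.1 and Remark 1.8 (1)]
[cite: Mazur1977, Ch. III §5, Step 1, p. 158] -/
theorem eq_zero_of_prime_nsmul_eq_zero_of_mem_nonsingularReductionSubgroup_short (h11 : 11 ≤ p)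
    {A B : ℤ_[p]} (hA : ‖A‖ < 1) (hB : ‖B‖ < 1) [(curveK p L (shortCurve A B)).IsElliptic]
    (hL : ∀ z : L, ‖z‖ < 1 → ‖z‖ ≤ ‖(p : L)‖) {P : (curveK p L (shortCurve A B)).toAffine.Point}
    (hP : P ∈ ((shortCurve A B).map (coeffHom p L)).nonsingularReductionSubgroup
      (Valuation.integer.integers (NormedField.valuation (K := L))))
    (hpP : p • P = 0) : P = 0 := by
  rcases P with _ | ⟨x, y, h⟩
  · rfl
  · exfalso
    have hx := one_le_norm_of_some_mem_nonsingularReductionSubgroup_short hA hB h hP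
    obtain ⟨A', rfl⟩ : ∃ A', A = (p : ℤ_[p]) * A' := (PadicInt.norm_lt_one_iff_dvd A).mp hA
    obtain ⟨B', rfl⟩ : ∃ B', B = (p : ℤ_[p]) * B' := (PadicInt.norm_lt_one_iff_dvd B).mp hB
    obtain ⟨w, hw⟩ := exists_mul_eq_one_840 (p := p) h11
    have hf := norm_subtype_comp_coeffHom_le_one (p := p) (L := L)
    obtain ⟨hp0, hp1⟩ := norm_p_pos_lt (p := p) (K := L)
    haveI : ((shortCurve ((p : ℤ_[p]) * A') ((p : ℤ_[p]) * B')).map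
        ((unitBall L).subtype.comp (coeffHom p L))).IsElliptic := ‹_›
    refine not_prime_zsmul_eq_zero_of_one_le_norm_unramified ((unitBall L).subtype.comp (coeffHom p L)) hf
      (by omega) hw A' B' (norm_pos_iff.mp hp0) hp1 hL h hx ?_
    rw [natCast_zsmul]
    exact hpP

end KPort

end Summit.BirchSwinnertonDyer.BirchSwinnertonDyer.Theorems.ReceptacleTorsion

end
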